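import Summits.MatrixMultiplication.OmegaCensus.SmallFormats.RankOnePlaneCapGaugeResidual
import HarnessLib

/-!
# ω-census family (a): the second `GL₂` factor of the 'zero' position (the `K`-block of the first `R₂` term)

Cell `pub-omega` (unit `pub-omega-eng1`, gen 33), topic `Summits/MatrixMultiplication/OmegaCensus`
(sub-folder `SmallFormats`). Framing (verbatim): lottery ticket; floor = certified bounds/negative
ranges. HONEST FRAMING: the last untyped factor of tensor's `JOB_NORM3` residual normalisation
(lead g36 NORM3-MAP, 2026-08-28): in the 'zero' position of `gauge_normal_form_v12` the `R₂`-outputs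
live in `F′₂ = ⟨e₂,e₃⟩`, and `GL₂` acting on the columns `2,3` (`diag(I₂, N, 1)`) is a residual
symmetry: it keeps every `R₁`-output (columns `2,3,4` zero), the head of `i₀ ∈ R₁` (columns `0,1`),
the `{2,3}`-support of the `R₂`-outputs, column `4` of everything, the Y-forms on `E_{μν}` for
`ν ∈ {0,1,4}` (so the `θ₁ᵀG_i` zeros), and maps the pair `((θ₂ᵀG_i)₂, (θ₂ᵀG_i)₃)` linearly to itself
(so the `θ₂ᵀG_i` zeros of the zero position). Hence the `2×2` block `K = W_{j₀}[:, 2:4]` of any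
`j₀ ∈ R₂` can ALSO be brought to one of the six `GL₂` head forms (`head_canonical_GL2_gf3`).
`gauge_normal_form_v12_residualK` = `gauge_normal_form_v12` + (line: tail normal form) /
(zero: `K`-form AND pinned shear). With it every factor of NORM3 ('line' 6 tail forms; 'zero'
6 `K`-forms × the `2m+1` pinned chain) is an instance of a tree theorem. Not a bound on any rank,
not progress on `ω`.
-/

namespace Summit.MatrixMultiplication.OmegaCensus.RankOnePlaneCapGeneral

open Module Matrix Literature.Computability.AlgebraicComplexity

variable {k : Type*} [Field k] {c m : ℕ} {ι : Type*} [Fintype ι]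

/-! ### The block transform `diag(I₂, N, 1)` on columns `2,3` -/

/-- `x ↦ x · diag(I₂, N, 1)`: coordinates `0,1,4` unchanged, `(x₂,x₃) ↦ (x₂,x₃) N`. -/
theorem blockDiag23_fin5_apply (N : Matrix (Fin 2) (Fin 2) k) (x : Fin 5 → k) :
    let M : Matrix (Fin 5) (Fin 5) k :=
      !![1, 0, 0, 0, 0; 0, 1, 0, 0, 0; 0, 0, N 0 0, N 0 1, 0; 0, 0, N 1 0, N 1 1, 0; 0, 0, 0, 0, 1]
    (x ᵥ* M) 0 = x 0 ∧ (x ᵥ* M) 1 = x 1 ∧ (x ᵥ* M) 4 = x 4 ∧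
      (x ᵥ* M) 2 = x 2 * N 0 0 + x 3 * N 1 0 ∧ (x ᵥ* M) 3 = x 2 * N 0 1 + x 3 * N 1 1 := by
  intro M
  simp only [M, Matrix.vecMul, dotProduct, Fin.sum_univ_five]
  refine ⟨?_, ?_, ?_, ?_, ?_⟩ <;> simp

/-- `diag(I₂, N', 1) · diag(I₂, N, 1) = 1` for `N' N = 1`, and the rows of `E_{μν} · diag(I₂, N', 1)`:
unchanged for `ν ∈ {0,1,4}`, combinations of `E_{μ2}, E_{μ3}` for `ν ∈ {2,3}`. -/
theorem blockDiag23_fin5_gauge (N N' : Matrix (Fin 2) (Fin 2) k) (hN : N' * N = 1) :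
    let M : Matrix (Fin 5) (Fin 5) k :=
      !![1, 0, 0, 0, 0; 0, 1, 0, 0, 0; 0, 0, N 0 0, N 0 1, 0; 0, 0, N 1 0, N 1 1, 0; 0, 0, 0, 0, 1]
    let M' : Matrix (Fin 5) (Fin 5) k :=
      !![1, 0, 0, 0, 0; 0, 1, 0, 0, 0; 0, 0, N' 0 0, N' 0 1, 0; 0, 0, N' 1 0, N' 1 1, 0; 0, 0, 0, 0, 1]
    M' * M = 1 ∧
    (∀ μ : Fin m, ∀ ν : Fin 5, ν ≠ 2 → ν ≠ 3 →
      Matrix.single μ ν (1 : k) * M' = Matrix.single μ ν (1 : k)) ∧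
    (∀ μ : Fin m, Matrix.single μ (2 : Fin 5) (1 : k) * M' =
      N' 0 0 • Matrix.single μ (2 : Fin 5) (1 : k) + N' 0 1 • Matrix.single μ (3 : Fin 5) (1 : k)) ∧
    (∀ μ : Fin m, Matrix.single μ (3 : Fin 5) (1 : k) * M' =
      N' 1 0 • Matrix.single μ (2 : Fin 5) (1 : k) + N' 1 1 • Matrix.single μ (3 : Fin 5) (1 : k)) := by
  intro M M'
  have h00 : N' 0 0 * N 0 0 + N' 0 1 * N 1 0 = 1 := by
    have := congrFun (congrFun hN 0) 0; simpa [Matrix.mul_apply, Fin.sum_univ_two] using this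
  have h01 : N' 0 0 * N 0 1 + N' 0 1 * N 1 1 = 0 := by
    have := congrFun (congrFun hN 0) 1; simpa [Matrix.mul_apply, Fin.sum_univ_two] using this
  have h10 : N' 1 0 * N 0 0 + N' 1 1 * N 1 0 = 0 := by
    have := congrFun (congrFun hN 1) 0; simpa [Matrix.mul_apply, Fin.sum_univ_two] using this
  have h11 : N' 1 0 * N 0 1 + N' 1 1 * N 1 1 = 1 := by
    have := congrFun (congrFun hN 1) 1; simpa [Matrix.mul_apply, Fin.sum_univ_two] using this
  refine ⟨?_, fun μ ν h2 h3 => ?_, fun μ => ?_, fun μ => ?_⟩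
  · ext i j
    fin_cases i <;> fin_cases j <;> simp [M, M', Matrix.mul_apply, Fin.sum_univ_five, h00, h01, h10, h11]
  · ext a b
    by_cases ha : a = μ
    · subst ha
      fin_cases ν
      · fin_cases b <;> simp [M', Matrix.mul_apply, Matrix.single_apply]
      · fin_cases b <;> simp [M', Matrix.mul_apply, Matrix.single_apply]
      · exact absurd rfl h2
      · exact absurd rfl h3
      · fin_cases b <;> simp [M', Matrix.mul_apply, Matrix.single_apply]
    · have hμa : μ ≠ a := Ne.symm ha
      simp [Matrix.mul_apply, hμa]
  · ext a b
    by_cases ha : a = μ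
    · subst ha
      fin_cases b <;> simp [M', Matrix.mul_apply, Matrix.single_apply]
    · have hμa : μ ≠ a := Ne.symm ha
      simp [Matrix.mul_apply, hμa]
  · ext a b
    by_cases ha : a = μ
    · subst ha
      fin_cases b <;> simp [M', Matrix.mul_apply, Matrix.single_apply]
    · have hμa : μ ≠ a := Ne.symm ha
      simp [Matrix.mul_apply, hμa]

/-- **Column block transform on `{2,3}`.** For `N' N = 1`, a computation of `⟨c,m,5⟩` yields one with
the SAME X-forms, outputs `W_i ↦ W_i · diag(I₂,N,1)` (columns `0,1,4` unchanged, the `{2,3}`-pair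
multiplied by `N`), and Y-forms with `g'_i(E_{μν}) = g_i(E_{μν})` for `ν ∈ {0,1,4}` and
`g'_i(E_{μ2}), g'_i(E_{μ3})` the `N'`-combinations of `g_i(E_{μ2}), g_i(E_{μ3})`. -/
theorem exists_colBlock23 (β : BilinComp (mulBilin k c m 5) ι) (N N' : Matrix (Fin 2) (Fin 2) k)
    (hN : N' * N = 1) :
    ∃ β' : BilinComp (mulBilin k c m 5) ι,
      (∀ i, β'.f i = β.f i) ∧
      (∀ i κ, β'.w i κ 0 = β.w i κ 0 ∧ β'.w i κ 1 = β.w i κ 1 ∧ β'.w i κ 4 = β.w i κ 4 ∧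
        β'.w i κ 2 = β.w i κ 2 * N 0 0 + β.w i κ 3 * N 1 0 ∧
        β'.w i κ 3 = β.w i κ 2 * N 0 1 + β.w i κ 3 * N 1 1) ∧
      (∀ i (μ : Fin m) (ν : Fin 5), ν ≠ 2 → ν ≠ 3 →
        β'.g i (Matrix.single μ ν (1 : k)) = β.g i (Matrix.single μ ν (1 : k))) ∧
      (∀ i (μ : Fin m),
        β'.g i (Matrix.single μ (2 : Fin 5) (1 : k)) =
          N' 0 0 * β.g i (Matrix.single μ (2 : Fin 5) (1 : k)) + N' 0 1 * β.g i (Matrix.single μ (3 : Fin 5) (1 : k)) ∧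
        β'.g i (Matrix.single μ (3 : Fin 5) (1 : k)) =
          N' 1 0 * β.g i (Matrix.single μ (2 : Fin 5) (1 : k)) + N' 1 1 * β.g i (Matrix.single μ (3 : Fin 5) (1 : k))) := by
  obtain ⟨hMM, hfix, h2, h3⟩ := blockDiag23_fin5_gauge (m := m) N N' hN
  obtain ⟨β', hf, hg, hw⟩ := exists_colTransform β _ _ hMM
  refine ⟨β', hf, fun i κ => ?_, fun i μ ν hν2 hν3 => by rw [hg, hfix μ ν hν2 hν3],
    fun i μ => ⟨by rw [hg, h2 μ, map_add, map_smul, map_smul]; rfl,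
      by rw [hg, h3 μ, map_add, map_smul, map_smul]; rfl⟩⟩
  obtain ⟨e0, e1, e4, e2, e3⟩ := blockDiag23_fin5_apply N (β.w i κ)
  simp only [hw, mul_apply_eq_vecMul_gen]
  exact ⟨e0, e1, e4, e2, e3⟩

/-- The `θᵀG_i` zero pattern of the zero position survives the `{2,3}` block transform: coordinates
`ν ∈ {0,1,4}` are unchanged, and if coordinates `2` AND `3` vanish before, they vanish after. -/
theorem vecMul_gMatrix_block23 {β β' : BilinComp (mulBilin k c m 5) ι} {N' : Matrix (Fin 2) (Fin 2) k}
    (hfix : ∀ i (μ : Fin m) (ν : Fin 5), ν ≠ 2 → ν ≠ 3 →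
      β'.g i (Matrix.single μ ν (1 : k)) = β.g i (Matrix.single μ ν (1 : k)))
    (hmix : ∀ i (μ : Fin m),
      β'.g i (Matrix.single μ (2 : Fin 5) (1 : k)) =
        N' 0 0 * β.g i (Matrix.single μ (2 : Fin 5) (1 : k)) + N' 0 1 * β.g i (Matrix.single μ (3 : Fin 5) (1 : k)) ∧
      β'.g i (Matrix.single μ (3 : Fin 5) (1 : k)) =
        N' 1 0 * β.g i (Matrix.single μ (2 : Fin 5) (1 : k)) + N' 1 1 * β.g i (Matrix.single μ (3 : Fin 5) (1 : k)))
    (θ : Fin m → k) (i : ι) :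
    (∀ ν : Fin 5, ν ≠ 2 → ν ≠ 3 →
      (θ ᵥ* Matrix.of fun μ ν => β'.g i (Matrix.single μ ν (1 : k))) ν =
        (θ ᵥ* Matrix.of fun μ ν => β.g i (Matrix.single μ ν (1 : k))) ν) ∧
    ((θ ᵥ* Matrix.of fun μ ν => β.g i (Matrix.single μ ν (1 : k))) 2 = 0 →
      (θ ᵥ* Matrix.of fun μ ν => β.g i (Matrix.single μ ν (1 : k))) 3 = 0 →
      (θ ᵥ* Matrix.of fun μ ν => β'.g i (Matrix.single μ ν (1 : k))) 2 = 0 ∧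
      (θ ᵥ* Matrix.of fun μ ν => β'.g i (Matrix.single μ ν (1 : k))) 3 = 0) := by
  refine ⟨fun ν h2 h3 => ?_, fun hz2 hz3 => ?_⟩
  · simp only [Matrix.vecMul, dotProduct, Matrix.of_apply]
    exact Finset.sum_congr rfl fun μ _ => by rw [hfix i μ ν h2 h3]
  · simp only [Matrix.vecMul, dotProduct, Matrix.of_apply] at hz2 hz3 ⊢
    constructor
    · calc ∑ μ, θ μ * β'.g i (Matrix.single μ (2 : Fin 5) 1)
          = N' 0 0 * ∑ μ, θ μ * β.g i (Matrix.single μ (2 : Fin 5) 1) +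
            N' 0 1 * ∑ μ, θ μ * β.g i (Matrix.single μ (3 : Fin 5) 1) := by
            rw [Finset.mul_sum, Finset.mul_sum, ← Finset.sum_add_distrib]
            exact Finset.sum_congr rfl fun μ _ => by rw [(hmix i μ).1]; ring
        _ = 0 := by rw [hz2, hz3, mul_zero, mul_zero, add_zero]
    · calc ∑ μ, θ μ * β'.g i (Matrix.single μ (3 : Fin 5) 1)
          = N' 1 0 * ∑ μ, θ μ * β.g i (Matrix.single μ (2 : Fin 5) 1) +
            N' 1 1 * ∑ μ, θ μ * β.g i (Matrix.single μ (3 : Fin 5) 1) := by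
            rw [Finset.mul_sum, Finset.mul_sum, ← Finset.sum_add_distrib]
            exact Finset.sum_congr rfl fun μ _ => by rw [(hmix i μ).2]; ring
        _ = 0 := by rw [hz2, hz3, mul_zero, mul_zero, add_zero]

/-- The `{2,3}`-block of a `2 × 5` output after the block transform: `K ↦ K N`. -/
theorem block23_mul_eq (W W' : Matrix (Fin 2) (Fin 5) k) (N : Matrix (Fin 2) (Fin 2) k)
    (h2 : ∀ κ, W' κ 2 = W κ 2 * N 0 0 + W κ 3 * N 1 0)
    (h3 : ∀ κ, W' κ 3 = W κ 2 * N 0 1 + W κ 3 * N 1 1) :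
    !![W' 0 2, W' 0 3; W' 1 2, W' 1 3] = !![W 0 2, W 0 3; W 1 2, W 1 3] * N := by
  ext κ j
  fin_cases κ <;> fin_cases j <;> simp [h2, h3, Matrix.mul_apply, Fin.sum_univ_two]

/-! ### The v1.2 gauge with the `K`-form, the line tail and the pinned shear -/

/-- **`gauge_normal_form_v12` + `K`-form + line-tail + pinned shear.** As
`gauge_normal_form_v12_residual`, with additionally, in the ZERO branch, the `{2,3}`-block
`K = W_{j₀}[:,2:4]` of the chosen `j₀ ∈ R₂` in the six-element `GL₂` list. -/
theorem gauge_normal_form_v12_residualK [LinearOrder ι] (h17 : Fintype.card ι = 17)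
    (β : BilinComp (mulBilin (ZMod 3) 2 2 5) ι) {lam₁ lam₂ : Fin 2 → ZMod 3}
    (hlam₁ : lam₁ ≠ 0) (hlam₂ : lam₂ ≠ 0) (R₁ R₂ : Finset ι) (hdisj : Disjoint R₁ R₂)
    (hR₁ : ∀ i ∈ R₁, ∀ z : Fin 2 → ZMod 3, β.f i (vecMulVec z lam₁) = 0)
    (hR₂ : ∀ i ∈ R₂, ∀ z : Fin 2 → ZMod 3, β.f i (vecMulVec z lam₂) = 0)
    (hc₁ : R₁.card = 4) (hc₂ : R₂.card = 4) {i₀ j₀ : ι} (hi₀ : i₀ ∈ R₁) (hj₀ : j₀ ∈ R₂) :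
    ∃ β' : BilinComp (mulBilin (ZMod 3) 2 2 5) ι,
      (∀ i, β'.f i = β.f i) ∧
      (∀ i ∈ R₁, ∀ κ, β'.w i κ 2 = 0 ∧ β'.w i κ 3 = 0 ∧ β'.w i κ 4 = 0) ∧
      (∃ θ₁ : Fin 2 → ZMod 3, θ₁ ≠ 0 ∧ θ₁ ⬝ᵥ lam₁ = 0 ∧ ∀ i, i ∉ R₁ →
        (θ₁ ᵥ* Matrix.of fun μ ν => β'.g i (Matrix.single μ ν (1 : ZMod 3))) 0 = 0 ∧
        (θ₁ ᵥ* Matrix.of fun μ ν => β'.g i (Matrix.single μ ν (1 : ZMod 3))) 1 = 0) ∧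
      (((∀ i ∈ R₂, ∀ κ, β'.w i κ 1 = 0 ∧ β'.w i κ 3 = 0 ∧ β'.w i κ 4 = 0) ∧
          (∃ θ₂ : Fin 2 → ZMod 3, θ₂ ≠ 0 ∧ θ₂ ⬝ᵥ lam₂ = 0 ∧ ∀ i, i ∉ R₂ →
            (θ₂ ᵥ* Matrix.of fun μ ν => β'.g i (Matrix.single μ ν (1 : ZMod 3))) 0 = 0 ∧
            (θ₂ ᵥ* Matrix.of fun μ ν => β'.g i (Matrix.single μ ν (1 : ZMod 3))) 2 = 0) ∧
          !![β'.w i₀ 0 0, β'.w i₀ 0 1; β'.w i₀ 1 0, β'.w i₀ 1 1] ∈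
            ([!![0, 0; 0, 0], !![0, 0; 1, 0], !![0, 0; 0, 1], !![1, 0; 0, 0], !![1, 0; 1, 0],
              !![1, 0; 2, 0], !![0, 1; 0, 0], !![0, 1; 0, 1], !![0, 1; 0, 2], !![1, 0; 0, 1],
              !![0, 1; 1, 0], !![0, 1; 1, 1], !![0, 1; 1, 2]] :
              List (Matrix (Fin 2) (Fin 2) (ZMod 3))) ∧
          ((∀ i κ, β'.w i κ 3 = 0 ∧ β'.w i κ 4 = 0) ∨
            ∃ i₁, i₁ ∉ R₁ ∧ i₁ ∉ R₂ ∧ (∀ i, i < i₁ → ∀ κ, β'.w i κ 3 = 0 ∧ β'.w i κ 4 = 0) ∧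
              ((β'.w i₁ 0 = Pi.single 3 1 ∧ β'.w i₁ 1 = Pi.single 4 1) ∨
               (β'.w i₁ 0 = Pi.single 3 1 ∧ β'.w i₁ 1 4 = 0) ∨
               ((β'.w i₁ 0 3 = 0 ∧ β'.w i₁ 0 4 = 0) ∧ β'.w i₁ 1 = Pi.single 3 1)))) ∨
       ((∀ i ∈ R₂, ∀ κ, β'.w i κ 0 = 0 ∧ β'.w i κ 1 = 0 ∧ β'.w i κ 4 = 0) ∧
          (∃ θ₂ : Fin 2 → ZMod 3, θ₂ ≠ 0 ∧ θ₂ ⬝ᵥ lam₂ = 0 ∧ ∀ i, i ∉ R₂ →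
            (θ₂ ᵥ* Matrix.of fun μ ν => β'.g i (Matrix.single μ ν (1 : ZMod 3))) 2 = 0 ∧
            (θ₂ ᵥ* Matrix.of fun μ ν => β'.g i (Matrix.single μ ν (1 : ZMod 3))) 3 = 0) ∧
          !![β'.w i₀ 0 0, β'.w i₀ 0 1; β'.w i₀ 1 0, β'.w i₀ 1 1] ∈
            ([!![0, 0; 0, 0], !![1, 0; 0, 0], !![1, 0; 1, 0], !![1, 0; 2, 0], !![0, 0; 1, 0],
              !![1, 0; 0, 1]] : List (Matrix (Fin 2) (Fin 2) (ZMod 3))) ∧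
          !![β'.w j₀ 0 2, β'.w j₀ 0 3; β'.w j₀ 1 2, β'.w j₀ 1 3] ∈
            ([!![0, 0; 0, 0], !![1, 0; 0, 0], !![1, 0; 1, 0], !![1, 0; 2, 0], !![0, 0; 1, 0],
              !![1, 0; 0, 1]] : List (Matrix (Fin 2) (Fin 2) (ZMod 3))) ∧
          ((∀ i κ, β'.w i κ 4 = 0) ∨
            ∃ i₁, i₁ ∉ R₁ ∧ i₁ ∉ R₂ ∧ (∀ i, i < i₁ → ∀ κ, β'.w i κ 4 = 0) ∧
              (β'.w i₁ 0 = Pi.single 4 1 ∨ (β'.w i₁ 0 4 = 0 ∧ β'.w i₁ 1 = Pi.single 4 1))))) := by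
  classical
  obtain ⟨β₁, hf₁, hs₁, ⟨θ₁, hθ₁, hθ₁lam, hG₁⟩, hpos⟩ :=
    gauge_normal_form_v12 h17 β hlam₁ hlam₂ R₁ R₂ hdisj hR₁ hR₂ hc₁ hc₂ i₀
  rcases hpos with ⟨hl, ⟨θ₂, hθ₂, hθ₂lam, hG₂⟩, hmem⟩ | ⟨hz, ⟨θ₂, hθ₂, hθ₂lam, hG₂⟩, hmem⟩
  · -- 'line': exactly as in `gauge_normal_form_v12_residual`
    obtain ⟨β₂, hf₂, hg₂, hrow, hnf⟩ := lineTail_normal_form β₁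
    have hR₁row : ∀ i ∈ R₁, ∀ κ, β₂.w i κ = β₁.w i κ := fun i hi κ =>
      hrow i κ ⟨(hs₁ i hi κ).2.1, (hs₁ i hi κ).2.2⟩
    have hR₂row : ∀ i ∈ R₂, ∀ κ, β₂.w i κ = β₁.w i κ := fun i hi κ =>
      hrow i κ ⟨(hl i hi κ).2.1, (hl i hi κ).2.2⟩
    have hG : ∀ (θ : Fin 2 → ZMod 3) (i : ι) (ν : Fin 5), ν ≠ 3 → ν ≠ 4 →
        (θ ᵥ* Matrix.of fun μ ν => β₂.g i (Matrix.single μ ν (1 : ZMod 3))) ν =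
          (θ ᵥ* Matrix.of fun μ ν => β₁.g i (Matrix.single μ ν (1 : ZMod 3))) ν :=
      fun θ i ν h3 h4 => vecMul_gMatrix_eq_of_agree34 hg₂ θ i h3 h4
    refine ⟨β₂, fun i => by rw [hf₂, hf₁], fun i hi κ => by rw [hR₁row i hi κ]; exact hs₁ i hi κ,
      ⟨θ₁, hθ₁, hθ₁lam, fun i hi => ?_⟩, Or.inl ⟨fun i hi κ => by
        rw [hR₂row i hi κ]; exact hl i hi κ, ⟨θ₂, hθ₂, hθ₂lam, fun i hi => ?_⟩,
        by rw [hR₁row i₀ hi₀ 0, hR₁row i₀ hi₀ 1]; exact hmem, ?_⟩⟩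
    · rw [hG θ₁ i 0 (by decide) (by decide), hG θ₁ i 1 (by decide) (by decide)]; exact hG₁ i hi
    · rw [hG θ₂ i 0 (by decide) (by decide), hG θ₂ i 2 (by decide) (by decide)]; exact hG₂ i hi
    · rcases hnf with hall | ⟨i₁, hbefore, hforms⟩
      · exact Or.inl hall
      · have htail₁ : ∀ i ∈ R₁, ∀ κ, β₂.w i κ 3 = 0 := fun i hi κ => by
          rw [hR₁row i hi κ]; exact (hs₁ i hi κ).2.1
        have htail₂ : ∀ i ∈ R₂, ∀ κ, β₂.w i κ 3 = 0 := fun i hi κ => by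
          rw [hR₂row i hi κ]; exact (hl i hi κ).2.1
        have hpiv : β₂.w i₁ 0 3 = 1 ∨ β₂.w i₁ 1 3 = 1 := by
          rcases hforms with ⟨h0, -⟩ | ⟨h0, -⟩ | ⟨-, h1⟩
          · exact Or.inl (by rw [h0]; simp)
          · exact Or.inl (by rw [h0]; simp)
          · exact Or.inr (by rw [h1]; simp)
        have hn : ∀ R : Finset ι, (∀ i ∈ R, ∀ κ, β₂.w i κ 3 = 0) → i₁ ∉ R := by
          intro R hR h
          rcases hpiv with h3 | h3 <;> · rw [hR i₁ h] at h3; exact absurd h3 (by simp)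
        exact Or.inr ⟨i₁, hn R₁ htail₁, hn R₂ htail₂, hbefore, hforms⟩
  · -- 'zero': K-form on columns 2,3, then the pinned shear on column 4
    obtain ⟨p, q, r, s, hdet, hKmem⟩ :=
      head_canonical_GL2_gf3 (β₁.w j₀ 0 2) (β₁.w j₀ 0 3) (β₁.w j₀ 1 2) (β₁.w j₀ 1 3)
    set N : Matrix (Fin 2) (Fin 2) (ZMod 3) := !![p, q; r, s] with hNdef
    have hN : IsUnit N.det := by
      rw [hNdef, Matrix.det_fin_two_of, isUnit_iff_ne_zero]; simpa using hdet
    obtain ⟨β₂, hf₂, hw₂, hfix, hmix⟩ := exists_colBlock23 β₁ N N⁻¹ (Matrix.nonsing_inv_mul N hN)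
    -- v1.2 data after the K-step
    have hs₂ : ∀ i ∈ R₁, ∀ κ, β₂.w i κ 2 = 0 ∧ β₂.w i κ 3 = 0 ∧ β₂.w i κ 4 = 0 := by
      intro i hi κ
      obtain ⟨-, -, e4, e2, e3⟩ := hw₂ i κ
      obtain ⟨h2, h3, h4⟩ := hs₁ i hi κ
      exact ⟨by rw [e2, h2, h3]; ring, by rw [e3, h2, h3]; ring, by rw [e4, h4]⟩
    have hz₂ : ∀ i ∈ R₂, ∀ κ, β₂.w i κ 0 = 0 ∧ β₂.w i κ 1 = 0 ∧ β₂.w i κ 4 = 0 := by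
      intro i hi κ
      obtain ⟨e0, e1, e4, -, -⟩ := hw₂ i κ
      obtain ⟨h0, h1, h4⟩ := hz i hi κ
      exact ⟨by rw [e0, h0], by rw [e1, h1], by rw [e4, h4]⟩
    have hhead₂ : !![β₂.w i₀ 0 0, β₂.w i₀ 0 1; β₂.w i₀ 1 0, β₂.w i₀ 1 1] =
        !![β₁.w i₀ 0 0, β₁.w i₀ 0 1; β₁.w i₀ 1 0, β₁.w i₀ 1 1] := by
      rw [(hw₂ i₀ 0).1, (hw₂ i₀ 0).2.1, (hw₂ i₀ 1).1, (hw₂ i₀ 1).2.1]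
    have hK₂ : !![β₂.w j₀ 0 2, β₂.w j₀ 0 3; β₂.w j₀ 1 2, β₂.w j₀ 1 3] ∈
        ([!![0, 0; 0, 0], !![1, 0; 0, 0], !![1, 0; 1, 0], !![1, 0; 2, 0], !![0, 0; 1, 0],
          !![1, 0; 0, 1]] : List (Matrix (Fin 2) (Fin 2) (ZMod 3))) := by
      rw [block23_mul_eq (β₁.w j₀) (β₂.w j₀) N (fun κ => (hw₂ j₀ κ).2.2.2.1)
        (fun κ => (hw₂ j₀ κ).2.2.2.2), hNdef]
      exact hKmem
    have hG₁₂ : ∀ i, i ∉ R₁ →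
        (θ₁ ᵥ* Matrix.of fun μ ν => β₂.g i (Matrix.single μ ν (1 : ZMod 3))) 0 = 0 ∧
        (θ₁ ᵥ* Matrix.of fun μ ν => β₂.g i (Matrix.single μ ν (1 : ZMod 3))) 1 = 0 := by
      intro i hi
      obtain ⟨hfixν, -⟩ := vecMul_gMatrix_block23 hfix hmix θ₁ i
      rw [hfixν 0 (by decide) (by decide), hfixν 1 (by decide) (by decide)]; exact hG₁ i hi
    have hG₂₂ : ∀ i, i ∉ R₂ →
        (θ₂ ᵥ* Matrix.of fun μ ν => β₂.g i (Matrix.single μ ν (1 : ZMod 3))) 2 = 0 ∧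
        (θ₂ ᵥ* Matrix.of fun μ ν => β₂.g i (Matrix.single μ ν (1 : ZMod 3))) 3 = 0 := by
      intro i hi
      obtain ⟨-, hz23⟩ := vecMul_gMatrix_block23 hfix hmix θ₂ i
      exact hz23 (hG₂ i hi).1 (hG₂ i hi).2
    -- the pinned shear
    obtain ⟨β₃, hf₃, hg₃, hiff, hrow, hnf⟩ := shear_normal_form_pinned β₂
    have hR₁row : ∀ i ∈ R₁, ∀ κ, β₃.w i κ = β₂.w i κ := fun i hi κ => hrow i κ (hs₂ i hi κ).2.2
    have hR₂row : ∀ i ∈ R₂, ∀ κ, β₃.w i κ = β₂.w i κ := fun i hi κ => hrow i κ (hz₂ i hi κ).2.2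
    have hG : ∀ (θ : Fin 2 → ZMod 3) (i : ι) (ν : Fin 5), ν ≠ 4 →
        (θ ᵥ* Matrix.of fun μ ν => β₃.g i (Matrix.single μ ν (1 : ZMod 3))) ν =
          (θ ᵥ* Matrix.of fun μ ν => β₂.g i (Matrix.single μ ν (1 : ZMod 3))) ν :=
      fun θ i ν hν => vecMul_gMatrix_eq_of_agree hg₃ θ i hν
    refine ⟨β₃, fun i => by rw [hf₃, hf₂, hf₁], fun i hi κ => by
        rw [hR₁row i hi κ]; exact hs₂ i hi κ, ⟨θ₁, hθ₁, hθ₁lam, fun i hi => ?_⟩,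
      Or.inr ⟨fun i hi κ => by rw [hR₂row i hi κ]; exact hz₂ i hi κ,
        ⟨θ₂, hθ₂, hθ₂lam, fun i hi => ?_⟩,
        by rw [hR₁row i₀ hi₀ 0, hR₁row i₀ hi₀ 1, hhead₂]; exact hmem,
        by rw [hR₂row j₀ hj₀ 0, hR₂row j₀ hj₀ 1]; exact hK₂, ?_⟩⟩
    · rw [hG θ₁ i 0 (by decide), hG θ₁ i 1 (by decide)]; exact hG₁₂ i hi
    · rw [hG θ₂ i 2 (by decide), hG θ₂ i 3 (by decide)]; exact hG₂₂ i hi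
    · rcases hnf with hall | ⟨i₁, ρ, hpiv, habove, hbefore⟩
      · exact Or.inl hall
      · have h4₁ : ∀ i ∈ R₁, ∀ κ, β₃.w i κ 4 = 0 := fun i hi κ => by
          rw [hR₁row i hi κ]; exact (hs₂ i hi κ).2.2
        have h4₂ : ∀ i ∈ R₂, ∀ κ, β₃.w i κ 4 = 0 := fun i hi κ => by
          rw [hR₂row i hi κ]; exact (hz₂ i hi κ).2.2
        have hone : β₃.w i₁ ρ 4 = 1 := by rw [hpiv]; simp
        have hn : ∀ R : Finset ι, (∀ i ∈ R, ∀ κ, β₃.w i κ 4 = 0) → i₁ ∉ R := fun R hR h => by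
          have := hR i₁ h ρ; rw [hone] at this; exact absurd this (by simp)
        refine Or.inr ⟨i₁, hn R₁ h4₁, hn R₂ h4₂, hbefore, ?_⟩
        fin_cases ρ
        · exact Or.inl hpiv
        · exact Or.inr ⟨habove 0 (by decide), hpiv⟩

end Summit.MatrixMultiplication.OmegaCensus.RankOnePlaneCapGeneral
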